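import Summits.QuantumFields.BalabanUV.T4Continuum.Support.NE3CurvedFrameKill
import Summits.QuantumFields.BalabanUV.T4Continuum.Support.NE3CurvedCornerGaugeSpace
import HarnessLib

/-!
# NE3FrameFreeSliceW (T⁴ programme, node NE3, row K0b of the owner's ruling ρ-g22-2, file 1∕2) — THE SPACE `Ξ₀₀(W)` OF
# CORNER-TRIVIAL GAUGES WITH VANISHING NESTED BLOCK MEAN, THE PROJECTION ONTO `gaugeDir W (S)` FOR ANY `S ≤ Ξ₀`, AND THE CURVED
# FRAME-FREE SLICE `frameFreeBlockLandauW L N k W` (the owner's `T_♮(W)`) WITH ITS MIN-NORM PROPERTY (S6)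

NE3 (node U1b) formalisation swarm `b2b-balaban-t4-ne3-formalise-*`, leaf seat `b2b-balaban-t4-ne3-formalise-leaf-02` (gen 5), row
**K0** of ruling ρ-g22-2 («`T_♮(W)` as a Set at curved W + Φ6-W + min-norm at W → leaf-02-g5 ∕ leaf-01-g5»), sub-row **K0b**
(announced in `HOME/CLAIMS.log` ≈17:08Z); over this seat's K0a (`NE3CovariantBlockMean` p227610: `bmeanW`, `bmeanIterW`, the curved (‡)
`framePotW_gaugeDir`; `NE3CurvedFrameKill` p228017) and leaf-01-g5's curved T_pt kit `NE3CurvedCornerGaugeSpace` (p227091: `cornerGaugeSpace₀`,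
`eq_zero_of_gaugeDir_eq_zero`, the Gram∕Riesz pattern) BY NAME.  All [folklore], 0 sorry; two DATA defs (`cornerGaugeSpaceW`,
`frameFreeBlockLandauW`), no `def … : Prop`:
§8 `bmeanW_add`∕`bmeanW_smul`, `bmeanIterW_add`∕`bmeanIterW_smul`∕`bmeanIterW_zero'` (linearity of the transported block means);
§9 **`cornerGaugeSpaceW L k W P M`** = Ξ₀₀(W) := {ξ ∈ Ξ₀(P, M) : `bmeanIterW L k W ξ = 0`} as an `ℝ`-submodule (the gauge generators whose
   directions PRESERVE frame-freeness, by the curved (‡)), `mem_cornerGaugeSpaceW_iff`, `cornerGaugeSpaceW_le`;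
§10 **`exists_orthogonalW_of_le`** — the projection step for ANY sub-module `S ≤ Ξ₀(P, M)` (`P, M ≥ 1`, `W` `P`-periodic): every `Y` has
   `η ∈ S` with `Σ_{periodBox P} Σ_μ hsR (Y + gaugeDir W η) (gaugeDir W ζ) = 0` for all `ζ ∈ S` (Gram form of `gaugeDir W` on `S`,
   positive definite by leaf-01-g5's zero propagation, Riesz vector via `LinearMap.BilinForm.toDual`; their `exists_orthogonalW` is `S = Ξ₀`);
§11 **`frameFreeBlockLandauW L N k W : Set (Site d → Fin d → Matrix n n ℂ)`** = T_♮(W) := skew ∧ `IsPeriodicDir X (tower L N k)` ∧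
   `TangentIter L (k−1) W X` ∧ `framePotW L k W X = 0` ∧ `hsR`-orthogonal over `periodBox (tower L N k)` to `gaugeDir W μ` for every
   `μ ∈ Ξ₀₀(W)` — the owner's definition (ρ-g21-3 (V6): «the ℓ²-orthogonal complement, inside `ker d(avg^k) ∩ ker framePot_W`, of the
   block-mean-zero corner-trivial gauge orbit `D_W Ξ₀₀`»), stated BY ORTHOGONALITY so that ρ-g22-2a r1 (one transport convention) is
   automatic: the only transports are those inside `bmeanW` = leaf-04's `Fbar_gaugeDir` sum; at `W = 1` the clause is the flat slice's
   blockwise-constant divergence (leaf-02's `blockConst_of_orthogonal` ∕ `sum_hsR_eq_zero_of_blockConst`);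
   **(S6) `sum_nhsNormSq_add_gaugeDir_eq_of_mem`** (Pythagoras) and **`sum_nhsNormSq_le_of_mem`** (`‖X‖² ≤ ‖X + gaugeDir W μ‖²` for `X ∈ T_♮(W)`,
   `μ ∈ Ξ₀₀(W)`) — exact at ANY background, no smallness.
File 2 `NE3FrameFreeDecompositionW`: Φ6-W on T_♮(W) — (E_W) existence by frame-kill ∘ projection, (U_W)∕(D_W) uniqueness.
HONEST FRAMING.  Linear algebra and exact kinematics of OUR linearised averaging at a fixed background; nothing about Bałaban's
minimisers; (P♮)_W, (ML_w) at `W ≠ 1`, T-E_w and NE3 are NOT proved; spine PROVED 0∕9; finite T⁴ rung (B)+1 — NOT infinite volume, NOT mass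
gap, NOT BetaPertH, NOT Clay.  ABSOLUTE RULE kept: no printed sentence is a hypothesis (context only: [Balaban1985Averaging] (42)–(48)
pp. 23–25, (110)–(125) pp. 31–36; [Balaban1985Variational] (83) p. 290).  PLACEMENT: `Summits/QuantumFields/BalabanUV/`; imports this seat's
`NE3CurvedFrameKill` and leaf-01-g5's `NE3CurvedCornerGaugeSpace` BY NAME; moves nothing.  HONEST DEPENDENCY: continuum YM on T⁴ ⇐ BetaPertH
∧ nine spine estimates (0/9 proved); BetaPertH ⇐ (D1) ∧ (D4) ∧ CAP+tail; G-an2-4 gates asym, D1 and NE2/3/4.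
-/

set_option autoImplicit false

open scoped BigOperators Matrix.Norms.L2Operator
open Finset

namespace Summit.QuantumFields.BalabanUV.T4Continuum.NE3FrameFreeSliceW

open Literature.MathematicalPhysics.QuantumFieldTheory.Balaban1983to89
open B7Prop1Explicit B7Prop2Explicit MatrixNorms
open T4AveragingDeficitWall (IsUnitaryCfg IsSkewDir SmallField Ad)
open T4AveragingDeficitWallBoundary (IsPeriodicCfg periodBox mem_periodBox)
open AveragingDeficitPeriodicCounting (IsPeriodicDir)
open AveragingDeficitNearIdentity (Ad_add Ad_zero Ad_real_smul)
open AveragingDeficitChartCalculus (cavg)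
open AveragingDeficitMultiLevelPrep (cavgIter TangentIter tower LevelSmall)
open BlockAveragePushDirGauge (gaugeDir isPeriodicDir_gaugeDir)
open NE3TangentCovariantTower (framePotW)
open NE3CovariantCalculus (hsR hsR_add_left hsR_add_right hsR_self)
open NE3LandauOrbit (eq_zero_of_nhsNormSq_eq_zero nhsNormSq_add hsR_zero_right)
open NE3FrameFreeDecompositionPrep (hsR_smul_left hsR_smul_right)
open PeriodicChoice (apply_wrap_eq wrap_mem_periodBox)
open NE3CovariantBlockMean (bmeanW bmeanIterW bmeanIterW_zero bmeanIterW_succ)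
open NE3CurvedCornerGaugeSpace (cornerGaugeSpace₀ mem_cornerGaugeSpace₀_iff finiteDimensional_cornerGaugeSpace₀ gaugeDir_add_pi
  gaugeDir_smul_pi eq_zero_of_gaugeDir_eq_zero)

noncomputable section

variable {d : ℕ} {n : Type*} [Fintype n] [DecidableEq n]

/-! ## §8 Linearity of the transported block means -/

/-- `bmeanW` is additive. [folklore] -/
theorem bmeanW_add (L : ℕ) (W : Site d → Fin d → (Matrix n n ℂ)ˣ) (A B : Site d → Matrix n n ℂ) :
    bmeanW L W (A + B) = bmeanW L W A + bmeanW L W B := by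
  funext z
  simp only [bmeanW, Pi.add_apply, Ad_add, smul_add, Finset.sum_add_distrib]

/-- `bmeanW` commutes with real scalars. [folklore] -/
theorem bmeanW_smul (L : ℕ) (W : Site d → Fin d → (Matrix n n ℂ)ˣ) (t : ℝ) (A : Site d → Matrix n n ℂ) :
    bmeanW L W (t • A) = t • bmeanW L W A := by
  funext z
  simp only [bmeanW, Pi.smul_apply, Ad_real_smul, Finset.smul_sum, smul_comm t]

/-- `bmeanIterW` is additive. [folklore] -/
theorem bmeanIterW_add (L : ℕ) : ∀ (j : ℕ) (W : Site d → Fin d → (Matrix n n ℂ)ˣ) (A B : Site d → Matrix n n ℂ),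
    bmeanIterW L j W (A + B) = bmeanIterW L j W A + bmeanIterW L j W B
  | 0, _, _, _ => rfl
  | j + 1, W, A, B => by rw [bmeanIterW_succ, bmeanIterW_succ, bmeanIterW_succ, bmeanW_add, bmeanIterW_add L j]

/-- `bmeanIterW` commutes with real scalars. [folklore] -/
theorem bmeanIterW_smul (L : ℕ) : ∀ (j : ℕ) (W : Site d → Fin d → (Matrix n n ℂ)ˣ) (t : ℝ) (A : Site d → Matrix n n ℂ),
    bmeanIterW L j W (t • A) = t • bmeanIterW L j W A
  | 0, _, _, _ => rfl
  | j + 1, W, t, A => by rw [bmeanIterW_succ, bmeanIterW_succ, bmeanW_smul, bmeanIterW_smul L j]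

/-- `bmeanIterW L j W 0 = 0`. [folklore] -/
theorem bmeanIterW_zero' (L : ℕ) (j : ℕ) (W : Site d → Fin d → (Matrix n n ℂ)ˣ) :
    bmeanIterW L j W (0 : Site d → Matrix n n ℂ) = 0 := by
  have h := bmeanIterW_smul L j W 0 (0 : Site d → Matrix n n ℂ)
  rwa [zero_smul, zero_smul] at h

/-! ## §9 The space `Ξ₀₀(W)` of corner-trivial gauges with vanishing nested block mean -/

/-- **`Ξ₀₀(W)`** (`cornerGaugeSpaceW L k W P M`): the `ℝ`-submodule of `P`-periodic, corner-trivial (`ξ (M•w) = 0`), 𝔲(n)-valued site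
fields whose NESTED TRANSPORTED BLOCK MEAN through the `k`-fold tower at `W` vanishes (`bmeanIterW L k W ξ = 0`) — the gauge generators
whose directions PRESERVE frame-freeness (file 2, through the curved (‡) `NE3CovariantBlockMean.framePotW_gaugeDir`); at `W = 1` and
`M = L^k` it is leaf-02's flat `Ξ₀₀ = cornerGaugeSpace` (block sums zero). [folklore] -/
def cornerGaugeSpaceW (L k : ℕ) (W : Site d → Fin d → (Matrix n n ℂ)ˣ) (P M : ℕ) : Submodule ℝ (Site d → Matrix n n ℂ) where
  carrier := {ξ | ξ ∈ cornerGaugeSpace₀ (d := d) (n := n) P M ∧ bmeanIterW L k W ξ = 0}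
  zero_mem' := ⟨(cornerGaugeSpace₀ (d := d) (n := n) P M).zero_mem, bmeanIterW_zero' L k W⟩
  add_mem' := by
    rintro ξ ζ ⟨hξ, hξ0⟩ ⟨hζ, hζ0⟩
    exact ⟨(cornerGaugeSpace₀ (d := d) (n := n) P M).add_mem hξ hζ, by rw [bmeanIterW_add, hξ0, hζ0, add_zero]⟩
  smul_mem' := by
    rintro t ξ ⟨hξ, hξ0⟩
    exact ⟨(cornerGaugeSpace₀ (d := d) (n := n) P M).smul_mem t hξ, by rw [bmeanIterW_smul, hξ0, smul_zero]⟩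

/-- Membership in `Ξ₀₀(W)`, unfolded. [folklore] -/
theorem mem_cornerGaugeSpaceW_iff {L k : ℕ} {W : Site d → Fin d → (Matrix n n ℂ)ˣ} {P M : ℕ} {ξ : Site d → Matrix n n ℂ} :
    ξ ∈ cornerGaugeSpaceW (d := d) (n := n) L k W P M ↔ ξ ∈ cornerGaugeSpace₀ (d := d) (n := n) P M ∧ bmeanIterW L k W ξ = 0 :=
  Iff.rfl

/-- `Ξ₀₀(W) ≤ Ξ₀`. [folklore] -/
theorem cornerGaugeSpaceW_le (L k : ℕ) (W : Site d → Fin d → (Matrix n n ℂ)ˣ) (P M : ℕ) :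
    cornerGaugeSpaceW (d := d) (n := n) L k W P M ≤ cornerGaugeSpace₀ (d := d) (n := n) P M := fun _ h => h.1

/-! ## §10 The projection onto `gaugeDir W (S)` for any sub-module `S ≤ Ξ₀` -/

/-- **THE PROJECTION STEP ONTO A SUB-MODULE OF CORNER-TRIVIAL GAUGE DIRECTIONS** (`P, M ≥ 1`, `W` `P`-periodic): for every
`ℝ`-submodule `S ≤ Ξ₀(P, M)` and every direction field `Y` there is `η ∈ S` with `Y + gaugeDir W η` `hsR`-orthogonal over the period box to
`gaugeDir W ζ` for all `ζ ∈ S` — the Riesz vector of `ζ ↦ −Σ hsR Y (gaugeDir W ζ)` for the Gram form of `gaugeDir W` on `S`, which is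
positive definite by leaf-01-g5's zero propagation `NE3CurvedCornerGaugeSpace.eq_zero_of_gaugeDir_eq_zero` (their `exists_orthogonalW` is
the case `S = Ξ₀`). [folklore] -/
theorem exists_orthogonalW_of_le {P M : ℕ} (hP : 1 ≤ P) (hM : 1 ≤ M) {W : Site d → Fin d → (Matrix n n ℂ)ˣ}
    (hWP : IsPeriodicCfg W (P : ℤ)) (S : Submodule ℝ (Site d → Matrix n n ℂ))
    (hS : S ≤ cornerGaugeSpace₀ (d := d) (n := n) P M) (Y : Site d → Fin d → Matrix n n ℂ) :
    ∃ η ∈ S, ∀ ζ ∈ S, ∑ x ∈ periodBox (d := d) P, ∑ μ : Fin d, hsR (Y x μ + gaugeDir W η x μ) (gaugeDir W ζ x μ) = 0 := by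
  haveI := finiteDimensional_cornerGaugeSpace₀ (d := d) (n := n) hP M
  haveI : FiniteDimensional ℝ S := Submodule.finiteDimensional_of_le hS
  let G : LinearMap.BilinForm ℝ S :=
    LinearMap.mk₂ ℝ
      (fun η ζ => ∑ x ∈ periodBox (d := d) P, ∑ μ : Fin d,
        hsR (gaugeDir W (η : Site d → Matrix n n ℂ) x μ) (gaugeDir W (ζ : Site d → Matrix n n ℂ) x μ))
      (fun η η' ζ => by
        simp only [Submodule.coe_add, gaugeDir_add_pi, hsR_add_left, Finset.sum_add_distrib])
      (fun t η ζ => by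
        simp only [Submodule.coe_smul, gaugeDir_smul_pi, hsR_smul_left, Finset.mul_sum, smul_eq_mul])
      (fun η ζ ζ' => by
        simp only [Submodule.coe_add, gaugeDir_add_pi, hsR_add_right, Finset.sum_add_distrib])
      (fun t η ζ => by
        simp only [Submodule.coe_smul, gaugeDir_smul_pi, hsR_smul_right, Finset.mul_sum, smul_eq_mul])
  have hG : ∀ η ζ : S, G η ζ = ∑ x ∈ periodBox (d := d) P, ∑ μ : Fin d,
      hsR (gaugeDir W (η : Site d → Matrix n n ℂ) x μ) (gaugeDir W (ζ : Site d → Matrix n n ℂ) x μ) := fun _ _ => rfl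
  have key : ∀ η : S, G η η = 0 → η = 0 := by
    intro η h
    rw [hG] at h
    simp only [hsR_self] at h
    obtain ⟨hηP, hη0, -⟩ := mem_cornerGaugeSpace₀_iff.mp (hS η.2)
    have hbox : ∀ x ∈ periodBox (d := d) P, ∀ μ : Fin d, gaugeDir W (η : Site d → Matrix n n ℂ) x μ = 0 := by
      intro x hx μ
      have h1 := (Finset.sum_eq_zero_iff_of_nonneg fun y _ =>
        Finset.sum_nonneg fun ν _ => nhsNormSq_nonneg (gaugeDir W (η : Site d → Matrix n n ℂ) y ν)).1 h x hx
      have h2 := (Finset.sum_eq_zero_iff_of_nonneg fun ν _ =>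
        nhsNormSq_nonneg (gaugeDir W (η : Site d → Matrix n n ℂ) x ν)).1 h1 μ (Finset.mem_univ μ)
      exact eq_zero_of_nhsNormSq_eq_zero h2
    have hper := isPeriodicDir_gaugeDir hWP hηP
    have hall : ∀ (x : Site d) (μ : Fin d), gaugeDir W (η : Site d → Matrix n n ℂ) x μ = 0 := by
      intro x μ
      have hw := apply_wrap_eq (g := fun y => gaugeDir W (η : Site d → Matrix n n ℂ) y μ) (fun y κ => hper y κ μ) x
      rw [← hw]
      exact hbox _ (wrap_mem_periodBox P hP x) μ
    exact Subtype.ext (eq_zero_of_gaugeDir_eq_zero hM hall hη0)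
  have hGnd : G.Nondegenerate := ⟨fun η hη => key η (hη η), fun η hη => key η (hη η)⟩
  let ℓ : Module.Dual ℝ S :=
    { toFun := fun ζ => -∑ x ∈ periodBox (d := d) P, ∑ μ : Fin d, hsR (Y x μ) (gaugeDir W (ζ : Site d → Matrix n n ℂ) x μ)
      map_add' := fun ζ ζ' => by
        simp only [Submodule.coe_add, gaugeDir_add_pi, hsR_add_right, Finset.sum_add_distrib, neg_add]
      map_smul' := fun t ζ => by
        simp only [Submodule.coe_smul, gaugeDir_smul_pi, hsR_smul_right, Finset.mul_sum, RingHom.id_apply, smul_eq_mul,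
          mul_neg] }
  set η := (G.toDual hGnd).symm ℓ with hη_def
  refine ⟨η, η.2, fun ζ hζ => ?_⟩
  have h := LinearMap.BilinForm.apply_toDual_symm_apply (hB := hGnd) ℓ ⟨ζ, hζ⟩
  rw [← hη_def, hG] at h
  have hℓ : ℓ ⟨ζ, hζ⟩ = -∑ x ∈ periodBox (d := d) P, ∑ μ : Fin d, hsR (Y x μ) (gaugeDir W ζ x μ) := rfl
  rw [hℓ] at h
  simp only [hsR_add_left, Finset.sum_add_distrib]
  linarith

/-! ## §11 The curved frame-free slice `T_♮(W)` as a Set; the min-norm property (S6) -/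

/-- **THE CURVED FRAME-FREE SLICE `T_♮(W)`** (`frameFreeBlockLandauW L N k W`; ruling ρ-g21-3 (V6) ∕ ρ-g22-2 (V3), the slice of record
for the curved step of route H♮): skew, `(tower L N k)`-periodic directions, TANGENT to the `k`-fold average at `W`
(`TangentIter L (k−1) W`), FRAME-FREE (`framePotW L k W X = 0`), and `hsR`-ORTHOGONAL over the period box to the gauge directions
`gaugeDir W μ` of every `μ ∈ Ξ₀₀(W)` (= the owner's «ℓ²-orthogonal complement, inside `ker d(avg^k) ∩ ker framePot_W`, of the
block-mean-zero corner-trivial gauge orbit `D_W Ξ₀₀`»; at `W = 1` the orthogonality clause is the blockwise-constant divergence clause of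
`NE3FrameFreeSlice.frameFreeBlockLandau`, by leaf-02's `blockConst_of_orthogonal` ∕ `sum_hsR_eq_zero_of_blockConst`). [folklore] -/
def frameFreeBlockLandauW (L N k : ℕ) (W : Site d → Fin d → (Matrix n n ℂ)ˣ) : Set (Site d → Fin d → Matrix n n ℂ) :=
  {X | IsSkewDir X ∧ IsPeriodicDir X ((tower L N k : ℕ) : ℤ) ∧ TangentIter L (k - 1) W X ∧ (∀ z : Site d, framePotW L k W X z = 0)
      ∧ ∀ μ ∈ cornerGaugeSpaceW (d := d) (n := n) L k W (tower L N k) (L ^ k),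
          ∑ x ∈ periodBox (d := d) (tower L N k), ∑ κ : Fin d, hsR (X x κ) (gaugeDir W μ x κ) = 0}

/-- **(S6) MIN-NORM ON `T_♮(W)`, BY PYTHAGORAS**: for `X ∈ frameFreeBlockLandauW L N k W` and `μ ∈ Ξ₀₀(W)`,
`Σ_{periodBox} Σ_κ nhsNormSq (X x κ + gaugeDir W μ x κ) = Σ nhsNormSq (X x κ) + Σ nhsNormSq (gaugeDir W μ x κ)`, hence
`Σ nhsNormSq X ≤ Σ nhsNormSq (X + gaugeDir W μ)` — exact at ANY background, no smallness. [folklore] -/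
theorem sum_nhsNormSq_add_gaugeDir_eq_of_mem {L N k : ℕ} {W : Site d → Fin d → (Matrix n n ℂ)ˣ}
    {X : Site d → Fin d → Matrix n n ℂ} (hX : X ∈ frameFreeBlockLandauW (d := d) (n := n) L N k W)
    {μ : Site d → Matrix n n ℂ} (hμ : μ ∈ cornerGaugeSpaceW (d := d) (n := n) L k W (tower L N k) (L ^ k)) :
    ∑ x ∈ periodBox (d := d) (tower L N k), ∑ κ : Fin d, nhsNormSq (X x κ + gaugeDir W μ x κ)
      = ∑ x ∈ periodBox (d := d) (tower L N k), ∑ κ : Fin d, nhsNormSq (X x κ)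
        + ∑ x ∈ periodBox (d := d) (tower L N k), ∑ κ : Fin d, nhsNormSq (gaugeDir W μ x κ) := by
  have horth := hX.2.2.2.2 μ hμ
  simp_rw [nhsNormSq_add, Finset.sum_add_distrib, ← Finset.mul_sum]
  rw [horth, mul_zero, add_zero]

/-- **(S6) `‖X‖² ≤ ‖X + gaugeDir W μ‖²`** on `T_♮(W)` against `Ξ₀₀(W)`. [folklore] -/
theorem sum_nhsNormSq_le_of_mem {L N k : ℕ} {W : Site d → Fin d → (Matrix n n ℂ)ˣ}
    {X : Site d → Fin d → Matrix n n ℂ} (hX : X ∈ frameFreeBlockLandauW (d := d) (n := n) L N k W)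
    {μ : Site d → Matrix n n ℂ} (hμ : μ ∈ cornerGaugeSpaceW (d := d) (n := n) L k W (tower L N k) (L ^ k)) :
    ∑ x ∈ periodBox (d := d) (tower L N k), ∑ κ : Fin d, nhsNormSq (X x κ)
      ≤ ∑ x ∈ periodBox (d := d) (tower L N k), ∑ κ : Fin d, nhsNormSq (X x κ + gaugeDir W μ x κ) := by
  rw [sum_nhsNormSq_add_gaugeDir_eq_of_mem hX hμ]
  have : 0 ≤ ∑ x ∈ periodBox (d := d) (tower L N k), ∑ κ : Fin d, nhsNormSq (gaugeDir W μ x κ) :=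
    Finset.sum_nonneg fun _ _ => Finset.sum_nonneg fun _ _ => nhsNormSq_nonneg _
  linarith

end

end Summit.QuantumFields.BalabanUV.T4Continuum.NE3FrameFreeSliceW
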